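import Summits.CriticalPhenomena.Ising3DConformalLimit.Theorems.MoebiusLimitExists.Negative.FreeTranslations
import Mathlib.MeasureTheory.Measure.Lebesgue.Basic
import HarnessLib

/-!
# Mesh continuity: a full-filter pointwise scaling limit of lattice correlators is continuous off
the diagonals (the "good mesh" argument) — tightness lemma for the crux `MoebiusLimitExists`
(item stmt-CriticalPhenomena-1344; refuter `drefute`, line `only-interaction-breaks-moebius`,
whose `stub_compactness` asks cluster points to be `ContinuousOn … (NonCoincident 3 n)`; and
`stub_meshContinuity` of line `one-map-one-jet`)

The rescaled correlators `x ↦ ρ(δ)ⁿ G n ([x₁/δ],…,[xₙ/δ])` are constant on products of `δ`-cells. If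
they converge locally uniformly on `NonCoincident d n` as `δ → 0⁺` along the FULL filter, the limit
is continuous at every configuration none of whose coordinates vanishes: for two nearby
configurations `x, y` a mesh `δ ∈ [δ₁, 2δ₁]` putting every coordinate pair in a common `δ`-cell
exists, because the set of bad meshes has Lebesgue measure `≤ (#pairs)·(#multiples)·‖x−y‖ < δ₁`.
For the critical Ising correlators on `ℤ³` the coordinate hyperplanes are then removed by the FREE
translation invariance of any limit (`MoebiusLimitExistsNegative.limit_translate`), so EVERY
pointwise scaling limit `S` of `criticalCorr 3` has `ContinuousOn (S n) (NonCoincident 3 n)`.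
-/

noncomputable section

open Filter Topology Set Function MeasureTheory
open scoped ENNReal
open Literature.Probability.LatticeModels

namespace Summit.CriticalPhenomena.Ising3DConformalLimit.LimitMeshContinuity

/-! ### One-dimensional cell bookkeeping -/

/-- If `⌊a/δ⌋ ≠ ⌊b/δ⌋` (`a ≤ b`, `δ > 0`) then the multiple `⌊b/δ⌋·δ` of the mesh separates them:
`a < ⌊b/δ⌋ δ ≤ b`. [folklore] -/
theorem floor_mul_mem_of_floor_ne {a b δ : ℝ} (hδ : 0 < δ) (hab : a ≤ b)
    (h : ⌊a / δ⌋ ≠ ⌊b / δ⌋) : a < ⌊b / δ⌋ * δ ∧ (⌊b / δ⌋ : ℝ) * δ ≤ b := by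
  have hle : ⌊a / δ⌋ ≤ ⌊b / δ⌋ := Int.floor_le_floor (div_le_div_of_nonneg_right hab hδ.le)
  have hlt : ⌊a / δ⌋ < ⌊b / δ⌋ := lt_of_le_of_ne hle h
  constructor
  · have : a / δ < ⌊b / δ⌋ := Int.floor_lt.1 hlt
    rwa [div_lt_iff₀ hδ] at this
  · have : (⌊b / δ⌋ : ℝ) ≤ b / δ := Int.floor_le _
    rwa [le_div_iff₀ hδ] at this

/-- A GOOD mesh: if `δ ∈ [δ₁, 2δ₁]` avoids all the intervals `[lo/k, hi/k]`, `k ≤ N` (`N ≥ A/δ₁`),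
then any two reals `a, b ∈ [lo, hi] ⊆ (0, A]` lie in a common `δ`-cell. [folklore] -/
theorem floor_eq_of_good {a b lo hi δ δ₁ A : ℝ} {N : ℕ} (hδ₁ : 0 < δ₁) (hδ : δ ∈ Set.Icc δ₁ (2 * δ₁))
    (hlo : 0 < lo) (hA : A / δ₁ ≤ N) (ha : a ∈ Set.Icc lo hi) (hb : b ∈ Set.Icc lo hi) (hhi : hi ≤ A)
    (hgood : ∀ k : ℕ, k ≤ N → δ ∉ Set.Icc (lo / k) (hi / k)) : ⌊a / δ⌋ = ⌊b / δ⌋ := by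
  have hδpos : 0 < δ := lt_of_lt_of_le hδ₁ hδ.1
  -- symmetric in `a, b`: reduce to `a ≤ b`
  wlog hab : a ≤ b generalizing a b
  · exact (this hb ha (le_of_not_ge hab)).symm
  by_contra hne
  obtain ⟨h1, h2⟩ := floor_mul_mem_of_floor_ne hδpos hab hne
  set k : ℤ := ⌊b / δ⌋ with hk
  -- `k ≥ 1`
  have hkposR : (0:ℝ) < (k : ℝ) := by
    have hkδ : (0:ℝ) < (k : ℝ) * δ := lt_of_le_of_lt hlo.le (lt_of_le_of_lt ha.1 h1)
    by_contra hk0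
    push Not at hk0
    have : (k : ℝ) * δ ≤ 0 := mul_nonpos_of_nonpos_of_nonneg hk0 hδpos.le
    linarith
  have hkpos : 0 < k := by exact_mod_cast hkposR
  -- `k ≤ N`
  have hkN : (k : ℝ) ≤ N := by
    have hkb : (k : ℝ) * δ ≤ A := h2.trans (hb.2.trans hhi)
    have : (k : ℝ) ≤ A / δ₁ := by
      rw [le_div_iff₀ hδ₁]
      calc (k:ℝ) * δ₁ ≤ (k:ℝ) * δ := mul_le_mul_of_nonneg_left hδ.1 hkposR.le
        _ ≤ A := hkb
    exact this.trans hA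
  -- as a natural number
  obtain ⟨m, hm⟩ : ∃ m : ℕ, (k : ℤ) = m := ⟨k.toNat, (Int.toNat_of_nonneg hkpos.le).symm⟩
  have hmR : (k : ℝ) = (m : ℝ) := by exact_mod_cast hm
  have hmpos : (0:ℝ) < m := hmR ▸ hkposR
  have hmN : m ≤ N := by
    have : (m : ℝ) ≤ N := hmR ▸ hkN
    exact_mod_cast this
  apply hgood m hmN
  rw [hmR] at h1 h2
  constructor
  · rw [div_le_iff₀ hmpos, mul_comm]
    exact ha.1.trans h1.le
  · rw [le_div_iff₀ hmpos, mul_comm]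
    exact h2.trans hb.2

/-! ### The bad meshes have small measure -/

-- The set of BAD meshes for coordinate windows `[lo p, hi p]` is written out in full below:
-- `⋃ p, ⋃ k ∈ Finset.range (N + 1), Set.Icc (lo p / k) (hi p / k)` (some multiple `kδ`, `k ≤ N`,
-- falls in a window).

/-- Membership in the bad set. [folklore] -/
theorem mem_bad {P : Type*} {lo hi : P → ℝ} {N : ℕ} {δ : ℝ} (p : P) {k : ℕ} (hk : k ≤ N)
    (h : δ ∈ Set.Icc (lo p / k) (hi p / k)) : δ ∈ (⋃ p, ⋃ k ∈ Finset.range (N + 1), Set.Icc (lo p / (k : ℝ)) (hi p / (k : ℝ))) := by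
  refine Set.mem_iUnion.2 ⟨p, Set.mem_iUnion₂.2 ⟨k, ?_, h⟩⟩
  exact Finset.mem_range.2 (Nat.lt_succ_of_le hk)

/-- The bad meshes have Lebesgue measure `≤ #P · (N+1) · η` when every window has width `≤ η`
(each interval `[lo/k, hi/k]` has length `≤ η`). [folklore] -/
theorem volume_bad_le {P : Type*} [Fintype P] (lo hi : P → ℝ) (N : ℕ) {η : ℝ} (hη : 0 ≤ η)
    (hw : ∀ p, hi p - lo p ≤ η) :
    volume (⋃ p, ⋃ k ∈ Finset.range (N + 1), Set.Icc (lo p / (k : ℝ)) (hi p / (k : ℝ))) ≤ ENNReal.ofReal ((Fintype.card P : ℝ) * (N + 1) * η) := by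
  have hk : ∀ p, ∀ k ∈ Finset.range (N + 1),
      volume (Set.Icc (lo p / (k:ℝ)) (hi p / k)) ≤ ENNReal.ofReal η := by
    intro p k _
    rw [Real.volume_Icc, ← sub_div]
    apply ENNReal.ofReal_le_ofReal
    rcases Nat.eq_zero_or_pos k with h0 | hpos
    · subst h0; simp [hη]
    · have h1 : (1:ℝ) ≤ k := by exact_mod_cast hpos
      have hnn : 0 ≤ hi p - lo p ∨ hi p - lo p < 0 := le_or_gt 0 _
      rcases hnn with hnn | hneg
      · exact (div_le_self hnn h1).trans (hw p)
      · have : (hi p - lo p) / k < 0 := div_neg_of_neg_of_pos hneg (by exact_mod_cast hpos)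
        linarith
  calc volume (⋃ p, ⋃ k ∈ Finset.range (N + 1), Set.Icc (lo p / (k:ℝ)) (hi p / k))
      ≤ ∑ p, volume (⋃ k ∈ Finset.range (N + 1), Set.Icc (lo p / (k:ℝ)) (hi p / k)) :=
        measure_iUnion_fintype_le _ _
    _ ≤ ∑ p, ∑ k ∈ Finset.range (N + 1), volume (Set.Icc (lo p / (k:ℝ)) (hi p / k)) :=
        Finset.sum_le_sum fun p _ => measure_biUnion_finset_le _ _
    _ ≤ ∑ p : P, ∑ k ∈ Finset.range (N + 1), ENNReal.ofReal η :=
        Finset.sum_le_sum fun p _ => Finset.sum_le_sum fun k hk' => hk p k hk'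
    _ = ENNReal.ofReal ((Fintype.card P : ℝ) * (N + 1) * η) := by
        have hN1 : ENNReal.ofReal ((N:ℝ) + 1) = (N:ℝ≥0∞) + 1 := by
          rw [show ((N:ℝ) + 1) = ((N + 1 : ℕ) : ℝ) by push_cast; ring, ENNReal.ofReal_natCast]
          push_cast; ring
        rw [Finset.sum_const, Finset.sum_const, Finset.card_range, Finset.card_univ,
          nsmul_eq_mul, nsmul_eq_mul, ENNReal.ofReal_mul (by positivity),
          ENNReal.ofReal_mul (by positivity), ENNReal.ofReal_natCast, hN1]
        push_cast
        ring

/-- **Existence of a good mesh**: if `(#P)(N+1)η < δ₁` some `δ ∈ [δ₁, 2δ₁]` is not bad. [folklore] -/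
theorem exists_good {P : Type*} [Fintype P] (lo hi : P → ℝ) (N : ℕ) {η δ₁ : ℝ} (hη : 0 ≤ η)
    (hw : ∀ p, hi p - lo p ≤ η)
    (hsmall : (Fintype.card P : ℝ) * (N + 1) * η < δ₁) :
    ∃ δ ∈ Set.Icc δ₁ (2 * δ₁), δ ∉ (⋃ p, ⋃ k ∈ Finset.range (N + 1), Set.Icc (lo p / (k : ℝ)) (hi p / (k : ℝ))) := by
  by_contra hall
  push Not at hall
  have hsub : Set.Icc δ₁ (2 * δ₁) ⊆
      (⋃ p, ⋃ k ∈ Finset.range (N + 1), Set.Icc (lo p / (k : ℝ)) (hi p / (k : ℝ))) := fun δ hδ => hall δ hδ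
  have h1 := measure_mono (μ := volume) hsub
  rw [Real.volume_Icc] at h1
  have h2 := h1.trans (volume_bad_le lo hi N hη hw)
  rw [ENNReal.ofReal_le_ofReal_iff (by positivity)] at h2
  linarith

/-! ### Continuity at configurations with no vanishing coordinate (any lattice family, any `d`) -/

variable {d : ℕ}

/-- Two configurations whose coordinates lie pairwise in common `δ`-cells have the same rescaled
correlator (the rescaled correlators are cell-constant). [folklore] -/
theorem rescaledCorrelator_eq_of_floor_eq (G : LatticeCorrFamily d) (ρ : ℝ → ℝ) (n : ℕ) (δ : ℝ)
    {x y : Fin n → EuclideanSpace ℝ (Fin d)} (h : ∀ i j, ⌊x i j / δ⌋ = ⌊y i j / δ⌋) :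
    rescaledCorrelator G ρ n δ x = rescaledCorrelator G ρ n δ y := by
  have hxy : (fun i => latticeApprox δ (x i)) = fun i => latticeApprox δ (y i) := by
    funext i; funext j
    rw [latticeApprox_apply, latticeApprox_apply, h i j]
  rw [rescaledCorrelator_apply, rescaledCorrelator_apply, hxy]

/-- A coordinate is bounded by the configuration norm. [folklore] -/
theorem abs_coord_le {n : ℕ} (x : Fin n → EuclideanSpace ℝ (Fin d)) (i : Fin n) (j : Fin d) :
    |x i j| ≤ ‖x‖ :=
  (le_of_eq_of_le (Real.norm_eq_abs _).symm (PiLp.norm_apply_le (x i) j)).trans (norm_le_pi_norm x i)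

/-- **Mesh continuity, core**: a (full-filter) pointwise scaling limit is continuous within
`NonCoincident` at every non-coincident configuration all of whose coordinates are `≥ 1`. [folklore] -/
theorem continuousWithinAt_limit_of_one_le {G : LatticeCorrFamily d} {ρ : ℝ → ℝ} {S : CorrFamily d}
    (hlim : HasPointwiseScalingLimit G ρ S) {n : ℕ} {x₁ : Fin n → EuclideanSpace ℝ (Fin d)}
    (hx₁ : x₁ ∈ NonCoincident d n) (hpos : ∀ i j, 1 ≤ x₁ i j) :
    ContinuousWithinAt (S n) (NonCoincident d n) x₁ := by
  rw [Metric.continuousWithinAt_iff]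
  intro ε hε
  -- local uniformity at `x₁` with `ε/3`
  obtain ⟨t, ht, hev⟩ :=
    (Metric.tendstoLocallyUniformlyOn_iff.1 (hlim n)) (ε / 3) (by positivity) x₁ hx₁
  obtain ⟨r₁, hr₁, hball⟩ := Metric.mem_nhdsWithin_iff.1 ht
  rw [eventually_nhdsWithin_iff, Metric.eventually_nhds_iff] at hev
  obtain ⟨δ₀, hδ₀, hδ⟩ := hev
  -- constants
  set A : ℝ := ‖x₁‖ + 1 with hA
  set δ₁ : ℝ := δ₀ / 3 with hδ₁
  have hδ₁pos : 0 < δ₁ := by positivity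
  set N : ℕ := ⌈A / δ₁⌉₊ with hN
  set C : ℝ := (Fintype.card (Fin n × Fin d) : ℝ) * (N + 1) with hC
  have hCnn : 0 ≤ C := by positivity
  set η : ℝ := min (1 / 2) (min r₁ (δ₁ / (2 * (C + 1)))) with hη
  have hηpos : 0 < η := lt_min (by norm_num) (lt_min hr₁ (by positivity))
  have hη_half : η ≤ 1 / 2 := min_le_left _ _
  have hη_r : η ≤ r₁ := (min_le_right _ _).trans (min_le_left _ _)
  have hη_C : η ≤ δ₁ / (2 * (C + 1)) := (min_le_right _ _).trans (min_le_right _ _)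
  refine ⟨η, hηpos, fun {y} hyNC hdist => ?_⟩
  -- coordinate windows
  have hcoord : ∀ i j, |y i j - x₁ i j| < η := by
    intro i j
    calc |y i j - x₁ i j| = |(y - x₁) i j| := by simp
      _ ≤ ‖y - x₁‖ := abs_coord_le _ i j
      _ = dist y x₁ := (dist_eq_norm _ _).symm
      _ < η := hdist
  let lo : Fin n × Fin d → ℝ := fun p => min (x₁ p.1 p.2) (y p.1 p.2)
  let hi : Fin n × Fin d → ℝ := fun p => max (x₁ p.1 p.2) (y p.1 p.2)
  have hw : ∀ p, hi p - lo p ≤ η := by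
    rintro ⟨i, j⟩
    have h := abs_lt.1 (hcoord i j)
    change max (x₁ i j) (y i j) - min (x₁ i j) (y i j) ≤ η
    rcases le_total (x₁ i j) (y i j) with hle | hle
    · rw [max_eq_right hle, min_eq_left hle]; linarith
    · rw [max_eq_left hle, min_eq_right hle]; linarith
  have hlo : ∀ p, (1 / 2 : ℝ) ≤ lo p := by
    rintro ⟨i, j⟩
    have h := abs_lt.1 (hcoord i j)
    have := hpos i j
    change (1 / 2 : ℝ) ≤ min (x₁ i j) (y i j)
    refine le_min (by linarith) (by linarith)
  have hhi : ∀ p, hi p ≤ A := by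
    rintro ⟨i, j⟩
    have h := abs_lt.1 (hcoord i j)
    have hx : x₁ i j ≤ ‖x₁‖ := (le_abs_self _).trans (abs_coord_le x₁ i j)
    change max (x₁ i j) (y i j) ≤ ‖x₁‖ + 1
    refine max_le (by linarith) (by linarith)
  -- a good mesh exists in `[δ₁, 2δ₁]`
  have hsmall : (Fintype.card (Fin n × Fin d) : ℝ) * (N + 1) * η < δ₁ := by
    change C * η < δ₁
    have h1 : C * η ≤ C * (δ₁ / (2 * (C + 1))) := mul_le_mul_of_nonneg_left hη_C hCnn
    have h2 : C * (δ₁ / (2 * (C + 1))) ≤ δ₁ / 2 := by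
      rw [show C * (δ₁ / (2 * (C + 1))) = (C / (C + 1)) * (δ₁ / 2) by field_simp]
      have : C / (C + 1) ≤ 1 := (div_le_one (by positivity)).2 (by linarith)
      calc (C / (C + 1)) * (δ₁ / 2) ≤ 1 * (δ₁ / 2) :=
            mul_le_mul_of_nonneg_right this (by positivity)
        _ = δ₁ / 2 := one_mul _
    linarith
  obtain ⟨δ, hδI, hgood⟩ := exists_good lo hi N hηpos.le hw hsmall
  have hδpos : 0 < δ := lt_of_lt_of_le hδ₁pos hδI.1
  have hδlt : δ < δ₀ := by
    have := hδI.2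
    rw [hδ₁] at this
    linarith
  have hAN : A / δ₁ ≤ N := Nat.le_ceil _
  -- hence all coordinate pairs of `x₁, y` sit in common `δ`-cells
  have hfloor : ∀ i j, ⌊x₁ i j / δ⌋ = ⌊y i j / δ⌋ := by
    intro i j
    refine floor_eq_of_good (lo := lo (i, j)) (hi := hi (i, j)) hδ₁pos hδI
      (by linarith [hlo (i, j)]) hAN ⟨min_le_left _ _, le_max_left _ _⟩
      ⟨min_le_right _ _, le_max_right _ _⟩ (hhi (i, j)) fun k hk hmem => ?_
    exact hgood (mem_bad (lo := lo) (hi := hi) (i, j) hk hmem)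
  have hFeq := rescaledCorrelator_eq_of_floor_eq G ρ n δ hfloor
  -- the uniform estimate at the good mesh, at `x₁` and at `y`
  have hx₁t : x₁ ∈ t := hball ⟨Metric.mem_ball_self hr₁, hx₁⟩
  have hyt : y ∈ t := hball ⟨Metric.mem_ball.2 (hdist.trans_le hη_r), hyNC⟩
  have hδball : dist δ 0 < δ₀ := by
    rw [Real.dist_eq, sub_zero, abs_of_pos hδpos]; exact hδlt
  have e1 := hδ hδball hδpos x₁ hx₁t
  have e2 := hδ hδball hδpos y hyt
  rw [← hFeq, dist_comm] at e2
  calc dist (S n y) (S n x₁)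
      ≤ dist (S n y) (rescaledCorrelator G ρ n δ x₁) + dist (rescaledCorrelator G ρ n δ x₁) (S n x₁) :=
        dist_triangle _ _ _
    _ < ε / 3 + ε / 3 := by
        refine add_lt_add ?_ ?_
        · rw [dist_comm]; exact e2
        · rw [dist_comm]; exact e1
    _ < ε := by linarith

/-! ### The critical Ising correlators on `ℤ³`: continuity on all of `NonCoincident` -/

/-- **Every pointwise scaling limit of the critical `ℤ³` Ising correlators is continuous off the
diagonals** (any renormalisation `ρ`): mesh continuity at configurations with positive coordinates,
transported everywhere by the free translation invariance of the limit
(`MoebiusLimitExistsNegative.limit_translate`). [folklore] -/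
theorem continuousOn_limit {ρ : ℝ → ℝ} {S : CorrFamily 3}
    (hlim : HasPointwiseScalingLimit (criticalCorr 3) ρ S) (n : ℕ) :
    ContinuousOn (S n) (NonCoincident 3 n) := by
  intro x₀ hx₀
  -- shift so that all coordinates are `≥ 1`
  set w : EuclideanSpace ℝ (Fin 3) :=
    EuclideanSpace.single 0 1 + EuclideanSpace.single 1 1 + EuclideanSpace.single 2 1 with hw_def
  have hw : ∀ j, w j = 1 := by
    intro j
    fin_cases j <;> simp [hw_def]
  set c : ℝ := ‖x₀‖ + 1 with hc
  set v : EuclideanSpace ℝ (Fin 3) := c • w with hv_def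
  have hv : ∀ j, v j = c := by
    intro j
    simp [hv_def, hw j]
  set x₁ : Fin n → EuclideanSpace ℝ (Fin 3) := fun i => x₀ i + v with hx₁_def
  have hx₁ : x₁ ∈ NonCoincident 3 n :=
    (Summit.CriticalPhenomena.Ising3DConformalLimit.MoebiusLimitExistsNegative.add_mem_nonCoincident_iff
      v x₀).2 hx₀
  have hpos : ∀ i j, 1 ≤ x₁ i j := by
    intro i j
    have h1 : x₁ i j = x₀ i j + c := by
      simp [hx₁_def, hv j]
    have h2 : |x₀ i j| ≤ ‖x₀‖ := abs_coord_le x₀ i j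
    have h3 := neg_abs_le (x₀ i j)
    rw [h1, hc]
    linarith
  have hcont := continuousWithinAt_limit_of_one_le hlim hx₁ hpos
  rw [Metric.continuousWithinAt_iff] at hcont ⊢
  intro ε hε
  obtain ⟨η, hη, h⟩ := hcont ε hε
  refine ⟨η, hη, fun {y} hy hdist => ?_⟩
  have hy₁ : (fun i => y i + v) ∈ NonCoincident 3 n :=
    (Summit.CriticalPhenomena.Ising3DConformalLimit.MoebiusLimitExistsNegative.add_mem_nonCoincident_iff
      v y).2 hy
  have hd : dist (fun i => y i + v) x₁ = dist y x₀ := by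
    rw [dist_eq_norm, dist_eq_norm]
    congr 1
    funext i
    simp [hx₁_def]
  have key := h hy₁ (by rw [hd]; exact hdist)
  rwa [Summit.CriticalPhenomena.Ising3DConformalLimit.MoebiusLimitExistsNegative.limit_translate hlim v hy,
    show S n x₁ = S n x₀ from
      Summit.CriticalPhenomena.Ising3DConformalLimit.MoebiusLimitExistsNegative.limit_translate hlim v hx₀]
    at key

/-! ### General lattice families: continuity from translation invariance of the limit -/

/-- **Mesh continuity for any lattice family in any dimension**, given translation invariance of
the limit (this is `stub_meshContinuity` of line `one-map-one-jet`, for every `d`): a full-filter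
pointwise scaling limit that is translation invariant is continuous off the diagonals. [folklore] -/
theorem continuousOn_limit_of_translationInvariant {G : LatticeCorrFamily d} {ρ : ℝ → ℝ}
    {S : CorrFamily d} (hlim : HasPointwiseScalingLimit G ρ S) (htr : IsTranslationInvariant S)
    (n : ℕ) : ContinuousOn (S n) (NonCoincident d n) := by
  intro x₀ hx₀
  set w : EuclideanSpace ℝ (Fin d) := WithLp.toLp 2 (fun _ : Fin d => (1:ℝ)) with hw_def
  have hw : ∀ j, w j = 1 := fun j => rfl
  set c : ℝ := ‖x₀‖ + 1 with hc
  set v : EuclideanSpace ℝ (Fin d) := c • w with hv_def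
  have hv : ∀ j, v j = c := by
    intro j
    simp [hv_def, hw j]
  set x₁ : Fin n → EuclideanSpace ℝ (Fin d) := fun i => x₀ i + v with hx₁_def
  have hadd : ∀ z : Fin n → EuclideanSpace ℝ (Fin d),
      (fun i => z i + v) ∈ NonCoincident d n ↔ z ∈ NonCoincident d n := fun z => by
    rw [mem_nonCoincident, mem_nonCoincident]
    exact (add_left_injective v).of_comp_iff z
  have hx₁ : x₁ ∈ NonCoincident d n := (hadd x₀).2 hx₀
  have hpos : ∀ i j, 1 ≤ x₁ i j := by
    intro i j
    have h1 : x₁ i j = x₀ i j + c := by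
      simp [hx₁_def, hv j]
    have h2 : |x₀ i j| ≤ ‖x₀‖ := abs_coord_le x₀ i j
    have h3 := neg_abs_le (x₀ i j)
    rw [h1, hc]
    linarith
  have hcont := continuousWithinAt_limit_of_one_le hlim hx₁ hpos
  rw [Metric.continuousWithinAt_iff] at hcont ⊢
  intro ε hε
  obtain ⟨η, hη, h⟩ := hcont ε hε
  refine ⟨η, hη, fun {y} hy hdist => ?_⟩
  have hy₁ : (fun i => y i + v) ∈ NonCoincident d n := (hadd y).2 hy
  have hd : dist (fun i => y i + v) x₁ = dist y x₀ := by
    rw [dist_eq_norm, dist_eq_norm]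
    congr 1
    funext i
    simp [hx₁_def]
  have key := h hy₁ (by rw [hd]; exact hdist)
  rwa [htr n v y, show S n x₁ = S n x₀ from htr n v x₀] at key

end Summit.CriticalPhenomena.Ising3DConformalLimit.LimitMeshContinuity

end
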